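import Summits.QuantumAdvantage.QuantumAdvantage.Theorems.SosSandwichTransferPBMachineDefs
import HarnessLib

/-!
# Route `SosSandwich`, crux `TransferPB` (stmt-QuantumAdvantage-15238): definitions of the HEAVY-PREFIX DESCENT (machine half of stub `stub_pbOracleSimulation`)

`Defs` file (D-0016 convention; objects the line `birth` posits, no theorem proved here). The machine half
(M⁺) of the corrected split `Theorems/SosSandwichTransferPBMachineSplitKept.lean` asks for a polynomial-time
transcript machine realising, for every answer function `g` consistent with `nodeProblem F r c k`, SOME
kept-sound advisor. This file fixes the REFERENCE ALGORITHM such a machine runs, as pure functions at the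
level of oracle STRINGS (a machine never handles `Fin (numOracleBits F x)` indices):

* `encSingleStr F x ρ u` — the SINGLE instance of the string `u` (`encSingle F x ρ s = encSingleStr F x ρ σ(s)`);
* `liveLevel blk j` — level `j` of the descent driven by the block-answer function `blk`: level `0` is `[[]]`
  if `blk [] = true` (else `[]`); level `j+1` lists, for each live `u` of level `j` in order, the children
  `u ++ [false]`, `u ++ [true]` answered `true`;
* `descentCands blk sgl W used` — the live strings of length `< W` whose single test `sgl` answers `true` and
  that are not in `used` (the strings already revealed on the path);
* `descentPick blk sgl W used` — the candidate of least canonical number `strNum` (`List.argmin`), if any;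
* `descentAdvisor F x g` — the advisor a machine running the descent with `blk u = g(BLOCK⟨x,ρ,u⟩)`,
  `sgl u = g(SINGLE⟨x,ρ,u⟩)`, `W = oracleWidth F x`, `used =` the strings of `ρ`, realises: pick the relevant bit
  of the picked string; leaf value `#{1 ≤ j ≤ 40 : g(MEAN⟨x,ρ,j⟩) = true}/40`.

Its kept-soundness (for EVERY `g`) and the polynomial size of the live levels under consistency are proved in
`Theorems/SosSandwichTransferPBDescent*.lean`.
Sources: S. Aaronson, A. Ambainis, Theory Comput. 10 (2014), proof of Thm. 23 (p. 14); C. H. Bennett,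
E. Bernstein, G. Brassard, U. Vazirani, SIAM J. Comput. 26 (1997), Cor. 3.4 (heavy strings are few); cell record
`Cruxes/TransferPB/Lines/birth-machine-spec.md`.
-/

-- D-0017: single-conjunct summit ⇒ the duplicate `QuantumAdvantage.QuantumAdvantage` is mandated.
set_option linter.dupNamespace false

noncomputable section

namespace Summit.QuantumAdvantage.QuantumAdvantage.Cruxes.TransferPB.Birth

open Finset Literature.Computability.Cryptography Literature.Computability.Complexity
  Literature.Computability.QuantumComplexity Literature.Computability.QuantumComplexity.ClassicalSimulation

namespace SimTreePB

section Strings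

variable (F : QCircuitFamily cliffordT) (x : List Bool)

/-- SINGLE instance of the STRING `u` after the path `ρ` (tag `01`): `encSingle F x ρ s` is
`encSingleStr F x ρ (bitString F x s)`. -/
def encSingleStr (ρ : List (Fin (numOracleBits F x) × Bool)) (u : List Bool) : List Bool :=
  boolPair x (boolPair (encPath F x ρ) (false :: true :: u))

end Strings

section Descent

/-- **Level `j` of the heavy-prefix descent** driven by the block answers `blk`: the strings of length `j` all of
whose prefixes (the empty one included) `blk` answers `true`, generated level by level — each live `u` spawns
the children `u ++ [false]`, `u ++ [true]` that `blk` answers `true`. [cite: BennettBernsteinBrassardVazirani1997, Cor. 3.4] -/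
def liveLevel (blk : List Bool → Bool) : ℕ → List (List Bool)
  | 0 => if blk [] = true then [[]] else []
  | j + 1 => (liveLevel blk j).flatMap fun u => [u ++ [false], u ++ [true]].filter fun v => blk v = true

/-- **The candidates of the descent**: live strings of length `< W` whose single test `sgl` answers `true` and
which are not among the already revealed strings `used`. -/
def descentCands (blk sgl : List Bool → Bool) (W : ℕ) (used : List (List Bool)) : List (List Bool) :=
  ((List.range W).flatMap (liveLevel blk)).filter fun u => sgl u = true ∧ u ∉ used

/-- **The pick of the descent**: the candidate of least canonical number `strNum` (none if there is no
candidate). -/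
def descentPick (blk sgl : List Bool → Bool) (W : ℕ) (used : List (List Bool)) : Option (List Bool) :=
  (descentCands blk sgl W used).argmin strNum

end Descent

section Adv

variable (F : QCircuitFamily cliffordT) (x : List Bool)

/-- **The advisor realised by a machine running the descent** with `blk u = g (BLOCK⟨x,ρ,u⟩)`,
`sgl u = g (SINGLE⟨x,ρ,u⟩)`, width `W = oracleWidth F x` and `used =` the strings revealed on `ρ`: pick the
relevant bit named by the picked string (a candidate always has length `< W`); leaf value
`#{1 ≤ j ≤ 40 : g (MEAN⟨x,ρ,j⟩) = true}/40`. [cite: AaronsonAmbainis2014, Thm. 23 (proof, p. 14)] -/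
def descentAdvisor (g : List Bool → Bool) : Advisor (numOracleBits F x) where
  pick ρ :=
    match descentPick (fun u => g (encBlock F x ρ u)) (fun u => g (encSingleStr F x ρ u)) (oracleWidth F x)
        (ρ.map fun e => bitString F x e.1) with
    | none => none
    | some u => if h : u.length < oracleWidth F x then some (bitEquiv F x ⟨u, mem_shortStrings.2 h⟩) else none
  val ρ := (((Icc 1 40).filter fun j => g (encMean F x ρ j) = true).card : ℝ) / 40

end Adv

end SimTreePB

end Summit.QuantumAdvantage.QuantumAdvantage.Cruxes.TransferPB.Birth

end
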